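import Summits.BirchSwinnertonDyer.BirchSwinnertonDyer.Theorems.SignedLowerHalvesSmallImageLowerHalfBothSignsRttCharRoadCoeffLattice
import Summits.BirchSwinnertonDyer.BirchSwinnertonDyer.Theorems.ResidualThetaTransportAtTwoResidualSignedLambdaLowerCMAtTwoAwayExhaustion
import Literature.NumberTheory.EllipticCurves.GreenbergSelmerNewform
import Literature.NumberTheory.GaloisRepresentations.GaloisRep
import Mathlib.RingTheory.Localization.Module
import HarnessLib

/-!
# Route `SignedLowerHalves`, crux L `SmallImageLowerHalfBothSigns` (stmt-BirchSwinnertonDyer-23599), line `rtt_w3` v12 — row T-2 / J-loc′ of INJ_top: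
# `𝒪_v`-LINEAR COORDINATES ON THE COFREE MODULE `(F_S/𝒪_S)(θ)` WITH VALUES IN `K_v/𝒪_v`, JOINTLY INJECTIVE

Hand `bsd-inputs-honda-p1` g20 (LEAD `cruxlead-stmt-BirchSwinnertonDyer-23599` g7, INPUT SPEC (I1)/(I2)/(I6): the family `s : Fin J → (M →+ TK)`);
helper `--supports stmt-BirchSwinnertonDyer-23599`; THEOREMS ONLY (no definition, no named fact, no instance, no `sorry`).  BSD / crux L / INJ_top / T-2
are NOT proved here.

Given a ring homomorphism `ι : 𝒪_v → 𝒪_S` (`𝒪_v = v.adicCompletionIntegers K`, `v ∣ p`; in T-2 the coefficient embedding of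
`…RttCharRoadCoeffEmbedding.exists_coeffRingHom` read on `𝒪_v`), ★★ `exists_cofree_coordinates`: there are finitely many additive maps
`c_i : Cofree θ F_S → K_v ⧸ 𝒪_v·1` (`i < d`, `d = rk_{𝒪_v} 𝒪_S`) which are `𝒪_v`-LINEAR (`c_i (ι b • m) = b • c_i m`) and JOINTLY INJECTIVE.
Construction: an `𝒪_v`-basis of `𝒪_S` (`…RttCharRoadCoeffLattice.moduleFree_of_coeffRingHom`) is a `K_v`-basis of `F_S = 𝒪_S[1/p]`
(`Basis.ofIsLocalizedModule`; `K_v → F_S` by `IsFractionRing.lift`); `c_i` = `i`-th coordinate modulo `𝒪_v` (it kills the lattice `𝒪_S`, whose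
coordinates are integral), and all `c_i m = 0` forces integral coordinates, i.e. `m ∈ 𝒪_S = 0`.  Composed with row J-curve's `α⁻¹ : K_v/𝒪_v ≅ W_K[p^∞]`
(`…RttCharRoadTorsionModule`) these are the coordinates `s_i` of T-2.

References: [NeukirchANT1999] Ch. II (6.8); [SerreLocalFields1979] Ch. II §2 Prop. 3; [GreenbergVatsal2000] §2 (p. 19); [KimPark2017] Def. 3.13.
-/

set_option autoImplicit false
-- D-0017: single-problem summit, the namespace repeats the problem name by design.
set_option linter.dupNamespace false
noncomputable section

open scoped Classical NumberField nonZeroDivisors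
open NumberField IsDedekindDomain IsDedekindDomain.HeightOneSpectrum Field
  Literature.NumberTheory.EllipticCurves Literature.NumberTheory.EllipticCurves.GreenbergSelmer
  Literature.NumberTheory.GaloisRepresentations

namespace Summit.BirchSwinnertonDyer.BirchSwinnertonDyer.Theorems.SmallImageRttCharRoad

section Coordinates

variable {K : Type} [Field K] [NumberField K] (v : HeightOneSpectrum (𝓞 K)) {p : ℕ} [hp : Fact p.Prime] {S : Set (PadicAlgCl p)}
  (θ : FramedGaloisRep K (padicCoeffIntegers S) 1) (ι : v.adicCompletionIntegers K →+* padicCoeffIntegers S)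

include hp in
/-- ★★ **`𝒪_v`-linear coordinates on `(F_S/𝒪_S)(θ)`, jointly injective.** For a ring homomorphism `ι : 𝒪_v → 𝒪_S` at `v ∣ p` (`F_S = ℚ_p(S)` finite
over `ℚ_p`) there are `d` additive maps `c_i : Cofree θ F_S → K_v ⧸ 𝒪_v·1` with `c_i (ι b • m) = b • c_i m` for all `b ∈ 𝒪_v` and
`(∀ i, c_i m = 0) → m = 0`.  (`d = rk_{𝒪_v} 𝒪_S`; the `c_i` are the coordinates in an `𝒪_v`-basis of `𝒪_S`, read modulo `𝒪_v`.)
[cite: NeukirchANT1999, Ch. II (6.8)] [cite: GreenbergVatsal2000, §2 (p. 19)] -/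
theorem exists_cofree_coordinates [FiniteDimensional ℚ_[p] (padicCoeffField S)] (hpv : ((p : ℕ) : 𝓞 K) ∈ v.asIdeal) :
    ∃ (d : ℕ) (c : Fin d → (Cofree θ (padicCoeffField S) →+
        (v.adicCompletion K ⧸ Submodule.span (v.adicCompletionIntegers K) {(1 : v.adicCompletion K)}))),
      (∀ (i : Fin d) (b : v.adicCompletionIntegers K) (m : Cofree θ (padicCoeffField S)), c i (ι b • m) = b • c i m) ∧
      (∀ m : Cofree θ (padicCoeffField S), (∀ i, c i m = 0) → m = 0) := by
  -- notation
  haveI : CharZero (v.adicCompletion K) := LocalField.charZero_adicCompletion v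
  letI algO : Algebra (v.adicCompletionIntegers K) (padicCoeffIntegers S) := ι.toAlgebra
  haveI : Module.Finite (v.adicCompletionIntegers K) (padicCoeffIntegers S) := moduleFinite_of_coeffRingHom v ι hpv
  haveI : Module.Free (v.adicCompletionIntegers K) (padicCoeffIntegers S) := moduleFree_of_coeffRingHom v ι hpv
  -- an `𝒪_v`-basis of `𝒪_S`
  set d := Module.finrank (v.adicCompletionIntegers K) (padicCoeffIntegers S) with hd
  let b := Module.finBasis (v.adicCompletionIntegers K) (padicCoeffIntegers S)
  -- `K_v → F_S` extending `ι`
  have hinjOL : Function.Injective (algebraMap (padicCoeffIntegers S) (padicCoeffField S)) := fun x y h ↦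
    Subtype.ext (congrArg (fun z : padicCoeffField S ↦ (z : PadicAlgCl p)) h)
  set g : v.adicCompletionIntegers K →+* padicCoeffField S := (algebraMap (padicCoeffIntegers S) (padicCoeffField S)).comp ι with hgdef
  have hg : Function.Injective g := hinjOL.comp (injective_coeffRingHom v ι hpv)
  let φ : v.adicCompletion K →+* padicCoeffField S := IsFractionRing.lift hg
  letI algF : Algebra (v.adicCompletion K) (padicCoeffField S) := φ.toAlgebra
  letI algO' : Algebra (v.adicCompletionIntegers K) (padicCoeffField S) := g.toAlgebra
  haveI : IsScalarTower (v.adicCompletionIntegers K) (v.adicCompletion K) (padicCoeffField S) :=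
    IsScalarTower.of_algebraMap_eq fun x ↦ (IsFractionRing.lift_algebraMap hg x).symm
  haveI : IsScalarTower (v.adicCompletionIntegers K) (padicCoeffIntegers S) (padicCoeffField S) :=
    IsScalarTower.of_algebraMap_eq fun _ ↦ rfl
  -- the `𝒪_v`-linear inclusion `𝒪_S → F_S` and `F_S = 𝒪_S[1/p]`
  let f : padicCoeffIntegers S →ₗ[v.adicCompletionIntegers K] padicCoeffField S :=
    (IsScalarTower.toAlgHom (v.adicCompletionIntegers K) (padicCoeffIntegers S) (padicCoeffField S)).toLinearMap
  have hf : ∀ y, f y = algebraMap (padicCoeffIntegers S) (padicCoeffField S) y := fun _ ↦ rfl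
  have hp0 : ((p : ℕ) : v.adicCompletionIntegers K) ≠ 0 := fun h ↦ by
    have h' := congrArg (fun z : v.adicCompletionIntegers K ↦ (z : v.adicCompletion K)) h
    push_cast at h'
    exact (Nat.cast_ne_zero.mpr hp.out.ne_zero) h'
  haveI : IsLocalizedModule (v.adicCompletionIntegers K)⁰ f := by
    refine ⟨fun c ↦ ?_, fun y ↦ ?_, fun {x₁ x₂} h ↦ ⟨1, by rw [hinjOL h]⟩⟩
    · have hc : algebraMap (v.adicCompletionIntegers K) (padicCoeffField S) (c : v.adicCompletionIntegers K) ≠ 0 := by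
        intro h0
        exact nonZeroDivisors.ne_zero c.2 (hg (by rw [map_zero]; exact h0))
      rw [Module.End.isUnit_iff]
      refine Function.bijective_iff_has_inverse.mpr
        ⟨fun m ↦ (algebraMap (v.adicCompletionIntegers K) (padicCoeffField S) (c : v.adicCompletionIntegers K))⁻¹ * m,
          fun m ↦ ?_, fun m ↦ ?_⟩
      · simp only [Module.algebraMap_end_apply, Algebra.smul_def]
        rw [← mul_assoc, inv_mul_cancel₀ hc, one_mul]
      · simp only [Module.algebraMap_end_apply, Algebra.smul_def]
        rw [← mul_assoc, mul_inv_cancel₀ hc, one_mul]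
    · obtain ⟨j, a, ha⟩ := ThetaTransport.ProfiniteExhaustion.exists_pow_mul_eq_algebraMap_padicCoeffIntegers S y
      refine ⟨(a, ⟨((p : ℕ) : v.adicCompletionIntegers K) ^ j, pow_mem (mem_nonZeroDivisors_of_ne_zero hp0) j⟩), ?_⟩
      change (((p : ℕ) : v.adicCompletionIntegers K) ^ j) • y = f a
      rw [hf, ha, Algebra.smul_def, map_pow, map_natCast]
  -- the induced `K_v`-basis of `F_S`
  let B := b.ofIsLocalizedModule (v.adicCompletion K) (v.adicCompletionIntegers K)⁰ f
  have hBrepr : ∀ (y : padicCoeffIntegers S) (i : Fin d),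
      B.repr (algebraMap (padicCoeffIntegers S) (padicCoeffField S) y) i =
        algebraMap (v.adicCompletionIntegers K) (v.adicCompletion K) (b.repr y i) := fun y i ↦ by
    rw [← hf]; exact b.ofIsLocalizedModule_repr_apply (v.adicCompletion K) (v.adicCompletionIntegers K)⁰ f y i
  have hBapply : ∀ i : Fin d, B i = algebraMap (padicCoeffIntegers S) (padicCoeffField S) (b i) := fun i ↦ by
    rw [← hf]; exact b.ofIsLocalizedModule_apply (v.adicCompletion K) (v.adicCompletionIntegers K)⁰ f i
  -- integral coordinates ⇒ integral element
  have hint : ∀ x : padicCoeffField S,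
      (∀ i : Fin d, ∃ a : v.adicCompletionIntegers K, B.repr x i = algebraMap (v.adicCompletionIntegers K) (v.adicCompletion K) a) →
      ∃ y : padicCoeffIntegers S, algebraMap (padicCoeffIntegers S) (padicCoeffField S) y = x := by
    intro x hx
    choose a ha using hx
    refine ⟨∑ i, a i • b i, ?_⟩
    rw [← B.sum_repr x, map_sum]
    refine Finset.sum_congr rfl fun i _ ↦ ?_
    rw [ha i, algebraMap_smul, hBapply, ← hf, ← hf, ← LinearMap.map_smul]
  -- the coordinate maps on `Fin 1 → F_S`
  let cvec : Fin d → ((Fin 1 → padicCoeffField S) →+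
      (v.adicCompletion K ⧸ Submodule.span (v.adicCompletionIntegers K) {(1 : v.adicCompletion K)})) := fun i ↦
    (((Submodule.span (v.adicCompletionIntegers K) {(1 : v.adicCompletion K)}).mkQ.toAddMonoidHom.comp
      (B.coord i).toAddMonoidHom).comp (Pi.evalAddMonoidHom (fun _ : Fin 1 ↦ padicCoeffField S) 0))
  have hcvec : ∀ (i : Fin d) (x : Fin 1 → padicCoeffField S), cvec i x = Submodule.Quotient.mk (B.repr (x 0) i) := fun _ _ ↦ rfl
  -- they kill the lattice `𝒪_S`
  have hkill : ∀ i : Fin d, (lattice 1 (padicCoeffIntegers S) (padicCoeffField S)).toAddSubgroup ≤ (cvec i).ker := by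
    intro i y hy
    obtain ⟨z, rfl⟩ := (mem_lattice_iff _).1 hy
    rw [AddMonoidHom.mem_ker, hcvec, Submodule.Quotient.mk_eq_zero, Submodule.mem_span_singleton]
    exact ⟨b.repr (z 0) i, by rw [Algebra.smul_def, mul_one, hBrepr]⟩
  -- the coordinates on `M`
  let c : Fin d → (Cofree θ (padicCoeffField S) →+
      (v.adicCompletion K ⧸ Submodule.span (v.adicCompletionIntegers K) {(1 : v.adicCompletion K)})) := fun i ↦
    QuotientAddGroup.lift (lattice 1 (padicCoeffIntegers S) (padicCoeffField S)).toAddSubgroup (cvec i) (hkill i)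
  have hc : ∀ (i : Fin d) (x : Fin 1 → padicCoeffField S),
      c i (cofreeMk (padicCoeffField S) θ x) = Submodule.Quotient.mk (B.repr (x 0) i) := fun i x ↦ by
    rw [← hcvec]; rfl
  refine ⟨d, c, fun i a m ↦ ?_, fun m hm ↦ ?_⟩
  · -- `𝒪_v`-linearity
    obtain ⟨x, rfl⟩ := cofreeMk_surjective (padicCoeffField S) θ m
    have hsm : ι a • x 0 = (algebraMap (v.adicCompletionIntegers K) (v.adicCompletion K) a) • x 0 := by
      rw [Algebra.smul_def, Algebra.smul_def, ← IsScalarTower.algebraMap_apply]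
      rfl
    rw [← LinearMap.map_smul, hc, hc, Pi.smul_apply, hsm, LinearEquiv.map_smul, Finsupp.smul_apply, ← Submodule.Quotient.mk_smul,
      smul_eq_mul, Algebra.smul_def]
  · -- joint injectivity
    obtain ⟨x, rfl⟩ := cofreeMk_surjective (padicCoeffField S) θ m
    have hx : ∀ i : Fin d, ∃ a : v.adicCompletionIntegers K,
        B.repr (x 0) i = algebraMap (v.adicCompletionIntegers K) (v.adicCompletion K) a := fun i ↦ by
      have h := hm i
      rw [hc, Submodule.Quotient.mk_eq_zero, Submodule.mem_span_singleton] at h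
      obtain ⟨a, ha⟩ := h
      exact ⟨a, by rw [← ha, Algebra.smul_def, mul_one]⟩
    obtain ⟨y, hy⟩ := hint (x 0) hx
    rw [← LinearMap.mem_ker, ker_cofreeMk, mem_lattice_iff]
    refine ⟨fun _ ↦ y, funext fun j ↦ ?_⟩
    rw [Subsingleton.elim j 0, hy]

end Coordinates

end Summit.BirchSwinnertonDyer.BirchSwinnertonDyer.Theorems.SmallImageRttCharRoad

end
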